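import Literature.NumberTheory.DiophantineGeometry.MordellCoprimeGreatestPrimeFactorProofs
import Literature.NumberTheory.LFunctions.RosserSchoenfeldPsiBound
import HarnessLib

/-!
# von Känel–Matschke, Corollary I (the greatest prime factor of `y² − x³`, explicit: `ε = 1/10`, `c = −20`) from
# Corollary 7.3 and the Rosser–Schoenfeld bound `ψ(x) < 1.03883 x` (proofs)

Topic `Literature/NumberTheory/DiophantineGeometry` (family `abc`). A proofs-only companion (theorems only; NO
definition, NO new named fact; D-0014, D-0026) of `MordellThueRamanujanNagellHeightBounds.lean`, where
**Corollary I** (§1.2.1) of R. von Känel, B. Matschke, arXiv:1605.06079 = Mem. AMS 286 (2023) [`VonkanelMatschke2023`]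
is typed as `corollaryI`: *"Suppose that `x, y ∈ ℤ` are coprime, and write `X = max(|x|,|y|)`. Then the greatest
rational prime divisor `p` of `y² − x³` exceeds `(1 − 1/10) log log X − 20`."* (= Cor. 7.4 with `ε = 1/10`: *"one
can take here the constant `c(ε) = −20`"*).

## The printed proof and how it is followed

Printed (§7.1, proof of Cor. 7.4): *"Let `S` be the set of rational primes dividing `a = y² − x³` and write
`q = max(S)`. The explicit version of the prime number theorem given in [Rosser–Schoenfeld] shows that
`log N_S ≤ ∑_{p ≤ q} log p ≤ q(1 + 1/(2 log q))`. Thus Corollary 7.3 implies …"*. Here the explicit input is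
Rosser–Schoenfeld 1962, Theorem 12, `ψ(x) < 1.03883 x` — the tree's named fact
`Literature.NumberTheory.LFunctions.RosserSchoenfeld1962_theorem_12` (DISCHARGED in the tree by
`RosserSchoenfeld1962_theorem_12_holds`, whose axiom closure is computational; it is therefore kept as a
hypothesis here) — giving `θ(q) ≤ ψ(q) < 1.03883 q`, which is weaker than the printed `q(1 + 1/(2 log q))` for
large `q` but enough for `ε = 1/10`: with `S = {p ∣ a}` (`f = |a|`, `α_S = 1728 N_S`, `gcd(x, y, N_S) = 1`)
Corollary 7.3 and `log N_S ≤ θ(q)` give (the analytic step of `MordellCoprimeGreatestPrimeFactorProofs`, here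
with `δ = 1/20`) `log log X ≤ 1.05 θ(q) + (log 3.75 + 7.63 + log 20 + 0.3815)`, so
`0.9 log log X − 20 ≤ 0.9817 q − 8.8 < q`.

## Main results

* `corollaryI_of_corollary_7_3 (h73 : corollary_7_3) (hRS : RosserSchoenfeld1962_theorem_12) : corollaryI`;
* `corollaryI_of_roots (hmod) (h104) (hi) (hRS) : corollaryI`.

No `abc` claim; axioms standard.
-/

noncomputable section

open Height
open scoped Chebyshev

namespace Literature.NumberTheory.DiophantineGeometry

namespace VonKanelMatschke

/-! ### Real-analysis helpers (copies of the private helpers of the Cor. 7.4 file) -/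

/-- `log 1728 ≤ 7.63`. [folklore] -/
private theorem log_1728_le₃ : Real.log 1728 ≤ 7.63 := by
  have hl2 := Real.log_two_lt_d9
  have h1 : Real.log (1728 : ℝ) ≤ Real.log 2048 := Real.log_le_log (by norm_num) (by norm_num)
  rw [show (2048 : ℝ) = 2 ^ 11 by norm_num, Real.log_pow] at h1
  push_cast at h1; linarith

/-- `log 1728 ≥ 7.43`. [folklore] -/
private theorem log_1728_ge₃ : (7.43 : ℝ) ≤ Real.log 1728 := by
  have hl2 := Real.log_two_gt_d9
  have he := Real.exp_one_lt_d9
  have h1 : Real.log 1728 = 10 * Real.log 2 + Real.log 1.6875 := by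
    rw [show (1728 : ℝ) = 2 ^ 10 * 1.6875 by norm_num, Real.log_mul (by norm_num) (by norm_num),
      Real.log_pow]; push_cast; ring
  have h2 : (1 / 2 : ℝ) ≤ Real.log 1.6875 := by
    rw [Real.le_log_iff_exp_le (by norm_num)]
    have hsq : Real.exp (1 / 2) ^ 2 = Real.exp 1 := by rw [← Real.exp_nat_mul]; norm_num
    have hpos : 0 < Real.exp (1 / 2 : ℝ) := Real.exp_pos _
    nlinarith
  rw [h1]; linarith

/-- The analytic step `log log X ≤ (1 + δ)T + C₁(δ)` (as in the Cor. 7.4 file). [folklore] -/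
private theorem loglog_le_of_height_bound' {lX α T δ : ℝ} (hlX0 : 0 ≤ lX)
    (hlX : lX ≤ 2 * α * Real.log α + 3 / 4 * α * Real.log (Real.log (Real.log α)) + 6 * α)
    (hα : 1728 ≤ α) (hT : 0 ≤ T) (hlogα : Real.log α ≤ 7.63 + T) (hδ : 0 < δ) :
    Real.log lX ≤ (1 + δ) * T + (Real.log 3.75 + 7.63 - Real.log δ + 7.63 * δ) := by
  have hα0 : 0 < α := by linarith
  have hlogα1 : 7.43 ≤ Real.log α := log_1728_ge₃.trans (Real.log_le_log (by norm_num) hα)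
  have hlogα0 : 0 < Real.log α := by linarith
  have hll : Real.log (Real.log α) ≤ Real.log α - 1 := Real.log_le_sub_one_of_pos hlogα0
  have hll0 : 0 < Real.log (Real.log α) := Real.log_pos (by linarith)
  have hl3 : Real.log (Real.log (Real.log α)) ≤ Real.log (Real.log α) - 1 :=
    Real.log_le_sub_one_of_pos hll0
  have p1 : α * Real.log (Real.log (Real.log α)) ≤ α * Real.log α :=
    mul_le_mul_of_nonneg_left (by linarith) hα0.le
  have p2 : α * 6 ≤ α * Real.log α := mul_le_mul_of_nonneg_left (by linarith) hα0.le
  have hG : lX ≤ 3.75 * α * Real.log α := by linarith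
  have hG1 : 1 < 3.75 * α * Real.log α := by
    have := mul_le_mul hα hlogα1 (by norm_num) hα0.le
    linarith
  have h1 : Real.log lX ≤ Real.log (3.75 * α * Real.log α) := by
    rcases eq_or_lt_of_le hlX0 with h0 | hpos
    · rw [← h0, Real.log_zero]; exact (Real.log_pos hG1).le
    · exact Real.log_le_log hpos hG
  have h2 : Real.log (3.75 * α * Real.log α) = Real.log 3.75 + Real.log α + Real.log (Real.log α) := by
    rw [Real.log_mul (by positivity) hlogα0.ne', Real.log_mul (by norm_num) hα0.ne']
  have h3 : Real.log (Real.log α) ≤ Real.log (7.63 + T) := Real.log_le_log hlogα0 hlogα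
  have h4 : Real.log (7.63 + T) ≤ -Real.log δ + δ * (7.63 + T) - 1 := by
    have hu : 0 < 7.63 + T := by linarith
    have h5 : Real.log (δ * (7.63 + T)) ≤ δ * (7.63 + T) - 1 :=
      Real.log_le_sub_one_of_pos (by positivity)
    rw [Real.log_mul hδ.ne' hu.ne'] at h5
    linarith
  linarith

/-! ### Corollary I -/

/-- **vKM Corollary I ⟸ {Corollary 7.3, Rosser–Schoenfeld `ψ(x) < 1.03883x`}** (PROVED; the printed route
Cor. 7.3 ⟹ Cor. 7.4 with an explicit Chebyshev bound, here RS 1962 Thm. 12 in place of the printed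
`θ(q) ≤ q(1 + 1/(2 log q))`). For `a = y² − x³ = 0` coprimality forces `|x| = |y| = 1`, `X = 1`.
[cite: VonkanelMatschke2023, Corollary I (§1.2.1) and Cor. 7.4 (arXiv §7.1, cor:coates2: "one can take c(1/10) = −20")] -/
theorem corollaryI_of_corollary_7_3 (h73 : corollary_7_3)
    (hRS : Literature.NumberTheory.LFunctions.RosserSchoenfeld1962_theorem_12) : corollaryI := by
  intro x y hcop
  classical
  set a : ℤ := y ^ 2 - x ^ 3 with hadef
  set L : ℝ := Real.log (Real.log ((max |x| |y| : ℤ) : ℝ)) with hLdef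
  have hX0 : (0 : ℤ) ≤ max |x| |y| := (abs_nonneg x).trans (le_max_left _ _)
  obtain ⟨n, hn⟩ := Int.eq_ofNat_of_zero_le hX0
  have hlX0 : 0 ≤ Real.log ((max |x| |y| : ℤ) : ℝ) := by
    rw [hn, Int.cast_natCast]
    rcases Nat.eq_zero_or_pos n with h0 | hpos
    · simp [h0]
    · exact Real.log_nonneg (by exact_mod_cast hpos)
  -- numerical constants: `log 3.75 ≤ 2 log 2`, `−log(1/20) ≤ 3`
  have hl2 := Real.log_two_lt_d9
  have he := Real.exp_one_gt_d9
  have hlog375 : Real.log 3.75 ≤ 1.3863 := by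
    have : Real.log (3.75 : ℝ) ≤ Real.log 4 := Real.log_le_log (by norm_num) (by norm_num)
    rw [show (4 : ℝ) = 2 ^ 2 by norm_num, Real.log_pow] at this; push_cast at this; linarith
  have hlog20 : -Real.log (1 / 20 : ℝ) ≤ 3 := by
    rw [Real.log_div (by norm_num) (by norm_num), Real.log_one, zero_sub, neg_neg,
      Real.log_le_iff_le_exp (by norm_num)]
    have : Real.exp 3 = Real.exp 1 ^ 3 := by rw [← Real.exp_nat_mul]; norm_num
    rw [this]
    calc (20 : ℝ) ≤ 2.7182818283 ^ 3 := by norm_num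
      _ ≤ Real.exp 1 ^ 3 := pow_le_pow_left₀ (by norm_num) he.le 3
  by_cases ha : a = 0
  · have hx3 : y ^ 2 = x ^ 3 := by have : y ^ 2 - x ^ 3 = 0 := ha; linarith
    have hux : IsUnit x :=
      (hcop.pow_right (n := 2)).isUnit_of_dvd' (dvd_refl x) ⟨x ^ 2, by rw [hx3]; ring⟩
    have huy : IsUnit y :=
      (hcop.pow_left (m := 3)).isUnit_of_dvd' ⟨y, by rw [← hx3]; ring⟩ (dvd_refl y)
    have hx1 : |x| = 1 := by rcases Int.isUnit_iff.mp hux with rfl | rfl <;> norm_num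
    have hy1 : |y| = 1 := by rcases Int.isUnit_iff.mp huy with rfl | rfl <;> norm_num
    have hL1 : L = 0 := by rw [hLdef, hx1, hy1, max_self]; simp
    have hq : a.natAbs.primeFactors.sup id = 0 := by rw [ha]; simp
    rw [hq, hL1]; push_cast; linarith
  · set S : Finset ℕ := a.natAbs.primeFactors with hSdef
    have hS : ∀ p ∈ S, p.Prime := fun p hp => Nat.prime_of_mem_primeFactors hp
    set q : ℕ := S.sup id with hqdef
    have hg : Int.gcd x y = 1 := Int.isCoprime_iff_gcd_eq_one.mp hcop
    have hgcd : Int.gcd (Int.gcd x y : ℤ) (primesProd S) = 1 := by rw [hg]; simp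
    have h := h73 S hS a ha x y hadef.symm hgcd
    have hf : sPart S a = a.natAbs := sPart_primeFactors_self ha
    have hαN : alphaLevel S (a : ℚ) = 1728 * primesProd S := alphaLevel_primeFactors a
    have haR : (a.natAbs : ℝ) ≠ 0 := by exact_mod_cast Int.natAbs_ne_zero.mpr ha
    rw [hf, div_self haR, Real.log_one, mul_zero, zero_add, hαN] at h
    have hN1 := one_le_primesProd hS
    have hα1728 : (1728 : ℝ) ≤ ((1728 * primesProd S : ℕ) : ℝ) := by
      exact_mod_cast Nat.le_mul_of_pos_right _ hN1
    have hT0 : 0 ≤ Chebyshev.theta q := Chebyshev.theta_nonneg _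
    have hlogα : Real.log ((1728 * primesProd S : ℕ) : ℝ) ≤ 7.63 + Chebyshev.theta q := by
      have hN0 : (0 : ℝ) < primesProd S := by exact_mod_cast hN1
      rw [Nat.cast_mul, Nat.cast_ofNat, Real.log_mul (by norm_num) hN0.ne']
      have := log_primesProd_le_theta hS
      linarith [log_1728_le₃]
    have KEY : L ≤ (1 + 1 / 20) * Chebyshev.theta q +
        (Real.log 3.75 + 7.63 - Real.log (1 / 20) + 7.63 * (1 / 20)) :=
      loglog_le_of_height_bound' hlX0 h hα1728 hT0 hlogα (by norm_num)
    -- `θ(q) ≤ ψ(q) ≤ 1.03883 q`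
    have hq0 : (0 : ℝ) ≤ q := Nat.cast_nonneg q
    have hT : Chebyshev.theta q ≤ 1.03883 * q := by
      refine (Chebyshev.theta_le_psi _).trans ?_
      rcases eq_or_lt_of_le hq0 with h0 | hpos
      · rw [← h0, Chebyshev.psi_zero]; norm_num
      · exact (hRS q hpos).le
    linarith

/-- **vKM Corollary I ⟸ {modularity, Lemma 10.4, Prop. 10.8 (i), Rosser–Schoenfeld Thm. 12}** (through
`corollary_7_3_of_roots`; the last hypothesis is discharged in the tree by
`Literature.NumberTheory.LFunctions.RosserSchoenfeld1962_theorem_12_holds`, computational axiom closure).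
[cite: VonkanelMatschke2023, Corollary I (§1.2.1)] -/
theorem corollaryI_of_roots
    (hmod : Literature.NumberTheory.EllipticCurves.ModularForms.nonempty_modularParametrizationData)
    (h104 : Literature.NumberTheory.EllipticCurves.ModularForms.vonKanelMatschke_lemma_10_4)
    (hi : Literature.NumberTheory.EllipticCurves.ModularForms.vonKanelMatschke_prop_10_8_i)
    (hRS : Literature.NumberTheory.LFunctions.RosserSchoenfeld1962_theorem_12) : corollaryI :=
  corollaryI_of_corollary_7_3 (corollary_7_3_of_roots hmod h104 hi) hRS

end VonKanelMatschke

end Literature.NumberTheory.DiophantineGeometry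

end
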